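import Summits.HodgeConjecture.HodgeConjecture.Theorems.Ring2WeilCoverageRealQuadraticUnitNorm
import HarnessLib

/-!
# Weil-type family coverage — THEOREM L (i) at every level divisible by `12`: every unit of `ℤ[ζ_M]⁺` has norm `+1`
# when `12 ∣ M` (`ℚ(ζ_M)⁺ ∋ √3 = ζ₁₂ + ζ₁₂⁻¹`); the census levels `48`, `60`, `72`, `84` (and `36` again)

research route conditional on HC_CM; not a corollary; Q11.4-sentence-2 already refuted in dim ≥ 3.

Ring 2, WEIL-TYPE FAMILY-COVERAGE CENSUS (`HOME/WEIL-FAMILY-COVERAGE.md` `## b01`, blocks b01.28 THEOREM L, b01.34 (THEOREM L (i)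
elementary at `21/28/33/36/44`), b01.38 (`35/45`), b01.41–42 (the norm-sign law); owner ring2-b01), part 57 of the
`Ring2WeilCoverage*` series.  THEOREM L (i) («every unit of `ℚ(ζ_M)⁺` has norm `+1` to `ℚ`») is the obstruction input of
the census's polarisation criteria (parts 2, 48, 53, 55): it was in the tree only at the levels carrying a NO row
(`21, 28, 33, 36, 44, 35, 45`).  Part 8's elementary criterion `norm_units_eq_one_of_sq_eq` (a number field containing
`θ` with `θ² = D`, `D` no square, `q ∥ D` for a prime `q ≡ 3 (mod 4)`, has only units of norm `+1`) applies VERBATIM at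
every level `M` with `12 ∣ M`, through `√3 = ζ₁₂ + ζ₁₂⁻¹ ∈ ℚ(ζ_M)⁺`:

* §1 `sq_add_pow_eleven` — for a primitive `12`-th root of unity `η` in any field: `(η + η¹¹)² = 3`;
  `complexConj_add_pow_eleven` — in a CM field `η + η¹¹` is real.
* §2 **`norm_realUnits_pos_of_eq_twelve_mul`** — for `K ⊇ ℚ(ζ_M)` a CM number field with a primitive `M`-th root of
  unity `ζ`, `M = 12·m`: every unit `v` of `𝓞 K⁺` has `N_{K⁺/ℚ}(v) > 0` (`θ₀ = ζ^m + ζ^{11m}`).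
* §3 the census levels: **`norm_realUnits_pos_fortyEight`, `…_sixty`, `…_seventyTwo`, `…_eightyFour`** — THEOREM L (i)
  at `48, 60, 72, 84` (at `36` §2 re-proves part 9's `norm_realUnits_pos_thirtySix`), so the norm-sign law of parts 55/55b
  becomes two-sided on the sixteen YES rows of these levels (parts 56e/56f).

Not covered by this route: `32` (`ℚ(ζ₃₂)⁺ ⊇ ℚ(√2)` only), `40` (`√2, √5, √10`), `52` (`√13`) — no prime `q ≡ 3 (mod 4)`
divides the available `D` exactly once.

HONEST FRAMING: elementary algebra of roots of unity and part 8's norm transitivity; nothing here is a statement about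
Hodge classes, `W_K`, general members or HC; `HC_CM` is used nowhere.  No `def`, no named fact, no `sorry`.

References: [cite: Washington1997, §8.1, Prop. 2.16]; census b01.28 / b01.34 (seat-derived).
-/

noncomputable section

open Module NumberField Polynomial
open scoped nonZeroDivisors

namespace Summit.HodgeConjecture.Ring2WeilCoverage.RealUnitNormTwelve

open Summit.HodgeConjecture.Ring2WeilCoverage.RealQuadraticUnitNorm

variable {K : Type} [Field K] [NumberField K] [IsCMField K]

/-! ### §1 `√3 = η + η⁻¹` for a primitive `12`-th root of unity `η` -/

omit [NumberField K] [IsCMField K] in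
/-- **`(η + η¹¹)² = 3`** for a primitive `12`-th root of unity `η` (`x = η²` is a primitive `6`-th root: `x³ = −1`,
`x ≠ −1`, so `x² − x + 1 = 0`, and `(η + η⁻¹)² = x + 2 + x⁻¹ = 3`).
research route conditional on HC_CM; not a corollary; Q11.4-sentence-2 already refuted in dim ≥ 3. [folklore] -/
theorem sq_add_pow_eleven {η : K} (hη : IsPrimitiveRoot η 12) : (η + η ^ 11) ^ 2 = (3 : K) := by
  have h12 : η ^ 12 = 1 := hη.pow_eq_one
  have hx : IsPrimitiveRoot (η ^ 2) 6 := hη.pow (by norm_num) (by norm_num)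
  have h3 : (η ^ 2) ^ 3 = -1 := by
    have := hx.pow (by norm_num : 0 < 6) (show 6 = 3 * 2 by norm_num)
    exact this.eq_neg_one_of_two_right
  have hx1 : η ^ 2 ≠ -1 := by
    intro h
    have h2 : (η ^ 2) ^ 2 = 1 := by rw [h]; norm_num
    have := hx.pow_eq_one_iff_dvd 2 |>.mp h2
    omega
  have hq : (η ^ 2) ^ 2 - η ^ 2 + 1 = 0 := by
    have hfac : (η ^ 2 + 1) * ((η ^ 2) ^ 2 - η ^ 2 + 1) = 0 := by linear_combination h3
    rcases mul_eq_zero.mp hfac with h | h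
    · exact absurd (eq_neg_of_add_eq_zero_left h) hx1
    · exact h
  linear_combination (η ^ 10 + 2) * h12 + (η ^ 6 + η ^ 4 - 1) * hq

/-- **`η + η¹¹` is real** in a CM field (`η^ρ = η⁻¹ = η¹¹`).
research route conditional on HC_CM; not a corollary; Q11.4-sentence-2 already refuted in dim ≥ 3. [folklore] -/
theorem complexConj_add_pow_eleven {η : K} (hη : IsPrimitiveRoot η 12) :
    IsCMField.complexConj K (η + η ^ 11) = η + η ^ 11 := by
  have h12 : η ^ 12 = 1 := hη.pow_eq_one
  have hc : IsCMField.complexConj K η = η⁻¹ := complexConj_eq_inv_of_pow_eq_one (by norm_num) h12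
  have h1 : IsCMField.complexConj K η = η ^ 11 := by
    rw [hc]
    exact inv_eq_of_mul_eq_one_right (by linear_combination h12)
  have h11 : IsCMField.complexConj K (η ^ 11) = η := by
    rw [map_pow, hc, inv_pow]
    exact inv_eq_of_mul_eq_one_right (by linear_combination h12)
  rw [map_add, h1, h11, add_comm]

/-! ### §2 THEOREM L (i) whenever `12 ∣ M` -/

/-- **THEOREM L (i) at every level `M = 12·m`**: if the CM number field `K` contains a primitive `M`-th root of unity
`ζ` with `M = 12·m`, then every unit `v` of `𝓞 K⁺` has `N_{K⁺/ℚ}(v) > 0` — `K⁺ ∋ θ₀ = ζ^m + ζ^{11m}` with `θ₀² = 3`, and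
`3 ≡ 3 (mod 4)` (part 8 `norm_units_eq_one_of_sq_eq`).
research route conditional on HC_CM; not a corollary; Q11.4-sentence-2 already refuted in dim ≥ 3. [folklore] -/
theorem norm_realUnits_pos_of_eq_twelve_mul {ζ : K} {M m : ℕ} (hζ : IsPrimitiveRoot ζ M) (hm : 0 < m)
    (hM : M = 12 * m) (v : (𝓞 (maximalRealSubfield K))ˣ) :
    0 < Algebra.norm ℚ (((v : 𝓞 (maximalRealSubfield K)) : maximalRealSubfield K)) := by
  have hη : IsPrimitiveRoot (ζ ^ m) 12 := hζ.pow (by omega) (by rw [hM]; ring)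
  set θ₀ : K := ζ ^ m + (ζ ^ m) ^ 11 with hθ₀
  have hmem : θ₀ ∈ maximalRealSubfield K :=
    (IsCMField.complexConj_eq_self_iff K θ₀).mp (complexConj_add_pow_eleven hη)
  set θ : maximalRealSubfield K := ⟨θ₀, hmem⟩ with hθ
  have hD : θ ^ 2 = ((3 : ℕ) : maximalRealSubfield K) := by
    apply Subtype.ext
    push_cast
    exact sq_add_pow_eleven hη
  have hsq : ¬ IsSquare (3 : ℕ) := by
    rintro ⟨r, hr⟩
    have hr5 : r ≤ 2 := by nlinarith
    interval_cases r <;> omega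
  rw [norm_units_eq_one_of_sq_eq hD hsq Nat.prime_three (by norm_num) (by norm_num) (by norm_num) v]
  norm_num

/-! ### §3 The census levels `48, 60, 72, 84` -/

/-- **THEOREM L (i) at `M = 48`**: every unit of `𝓞(ℚ(ζ₄₈)⁺)` has positive norm (`√3 = ζ⁴ + ζ⁴⁴`).
research route conditional on HC_CM; not a corollary; Q11.4-sentence-2 already refuted in dim ≥ 3. [folklore] -/
theorem norm_realUnits_pos_fortyEight [IsCyclotomicExtension {48} ℚ K] {ζ : K} (hζ : IsPrimitiveRoot ζ 48)
    (v : (𝓞 (maximalRealSubfield K))ˣ) :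
    0 < Algebra.norm ℚ (((v : 𝓞 (maximalRealSubfield K)) : maximalRealSubfield K)) :=
  norm_realUnits_pos_of_eq_twelve_mul hζ (m := 4) (by norm_num) rfl v

/-- **THEOREM L (i) at `M = 60`**: every unit of `𝓞(ℚ(ζ₆₀)⁺)` has positive norm (`√3 = ζ⁵ + ζ⁵⁵`).
research route conditional on HC_CM; not a corollary; Q11.4-sentence-2 already refuted in dim ≥ 3. [folklore] -/
theorem norm_realUnits_pos_sixty [IsCyclotomicExtension {60} ℚ K] {ζ : K} (hζ : IsPrimitiveRoot ζ 60)
    (v : (𝓞 (maximalRealSubfield K))ˣ) :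
    0 < Algebra.norm ℚ (((v : 𝓞 (maximalRealSubfield K)) : maximalRealSubfield K)) :=
  norm_realUnits_pos_of_eq_twelve_mul hζ (m := 5) (by norm_num) rfl v

/-- **THEOREM L (i) at `M = 72`**: every unit of `𝓞(ℚ(ζ₇₂)⁺)` has positive norm (`√3 = ζ⁶ + ζ⁶⁶`).
research route conditional on HC_CM; not a corollary; Q11.4-sentence-2 already refuted in dim ≥ 3. [folklore] -/
theorem norm_realUnits_pos_seventyTwo [IsCyclotomicExtension {72} ℚ K] {ζ : K} (hζ : IsPrimitiveRoot ζ 72)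
    (v : (𝓞 (maximalRealSubfield K))ˣ) :
    0 < Algebra.norm ℚ (((v : 𝓞 (maximalRealSubfield K)) : maximalRealSubfield K)) :=
  norm_realUnits_pos_of_eq_twelve_mul hζ (m := 6) (by norm_num) rfl v

/-- **THEOREM L (i) at `M = 84`**: every unit of `𝓞(ℚ(ζ₈₄)⁺)` has positive norm (`√3 = ζ⁷ + ζ⁷⁷`).
research route conditional on HC_CM; not a corollary; Q11.4-sentence-2 already refuted in dim ≥ 3. [folklore] -/
theorem norm_realUnits_pos_eightyFour [IsCyclotomicExtension {84} ℚ K] {ζ : K} (hζ : IsPrimitiveRoot ζ 84)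
    (v : (𝓞 (maximalRealSubfield K))ˣ) :
    0 < Algebra.norm ℚ (((v : 𝓞 (maximalRealSubfield K)) : maximalRealSubfield K)) :=
  norm_realUnits_pos_of_eq_twelve_mul hζ (m := 7) (by norm_num) rfl v

end Summit.HodgeConjecture.Ring2WeilCoverage.RealUnitNormTwelve

end
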